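import Mathlib.MeasureTheory.Measure.Lebesgue.EqHaar
import Mathlib.MeasureTheory.Group.MeasurableEquiv
import Literature.MathematicalPhysics.KineticTheory.InfiniteChainDynamics
import HarnessLib

/-!
# Amplitude scaling of the infinite pinned chain, I: Gibbs states (DLR) under `σ ↦ s • σ`

Topic `Literature/MathematicalPhysics/KineticTheory`; companion of `InfiniteChainDynamics.lean`
(Gibbs specification `OscillatorChain.chainSpecification`, DLR states `IsChainGibbsMeasure`) for the
conjunct's family `pinnedChain ω₂ lam β γ` (`U = ω₂q²/2 + lam q⁴/4`, `V = r²/2 + β r⁴/4`,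
`FouriersLaw.lean`). Everything here is PROVED; no named fact is introduced.

## The statement (Aoki–Lukkarinen–Spohn 2006, §2; here for DLR states in infinite volume)

ALS (J. Stat. Phys. 124, arXiv:cond-mat/0602082), §2 eqs. (2.8)–(2.10): the change of variables
`q̃ = γq`, `p̃ = αγp` maps the anharmonic pinned chain onto itself with rescaled couplings,
`H = (αγ)⁻² H̃`; after (2.12): "the conductivity depends on the anharmonic coupling and the
temperature only through `λT`" (2.13); "Thus the limit `T → 0` … corresponds to the limit `λ → 0`".
For the tree's `pinnedChain` and the pure amplitude dilation `S_s(q, p) = (sq, sp)` (no time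
change) the energy identity is `H^{lam,β}_Λ(s • σ) = s² H^{lam s²,β s²}_Λ(σ)` in every finite
volume, so the Boltzmann weight of the `(lam, β)` chain at temperature `s²T` evaluated at `s • σ`
is the weight of the `(lam s², β s²)` chain at temperature `T` at `σ`. This file proves the
measure-theoretic form of that remark for the DLR structure:

* `chainSpecification_smul`: for `s ≠ 0`, every finite `Λ` and boundary condition `η`,
  `γ^{lam,β; s²T}_Λ(· | s • η) = (γ^{lam s²,β s²; T}_Λ(· | η)) ∘ S_s⁻¹` — the Lebesgue Jacobian
  `|s|^{-2|Λ|}` of the a priori measure is a constant and is absorbed by the normalisation of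
  `Measure.tilted` (`tilted_of_smul_measure`), and tilting commutes with push-forward along a
  measurable equivalence up to pulling back the exponent (`tilted_map_equiv`);
* `isChainGibbsMeasure_map_dil` / `isChainGibbsMeasure_map_dil_iff`: `μ` is a Gibbs state of the
  `(lam s², β s²)` chain at `T` iff `μ ∘ S_s⁻¹` is a Gibbs state of the `(lam, β)` chain at `s²T`;
* `exists_isChainGibbsMeasure_iff_unit_temp`: Gibbs states of `pinnedChain ω₂ lam β γ` at `T > 0`
  correspond to Gibbs states of `pinnedChain ω₂ (lam T) (β T) γ` at temperature `1`
  (LOW TEMPERATURE = WEAK ANHARMONICITY, DLR form).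

The finite open chain with Langevin baths is treated in `HeatConductivity.lean` /
`Literature/Barriers/AtomisticToContinuum/LowTemperatureWeakAnharmonicity.lean` (steady states,
total current); the dynamical half for the infinite chain (solutions, `InfiniteChainDynamics`,
currents, Green–Kubo objects) is the sibling file `InfiniteChainAmplitudeScaling.lean`.

## Design notes

* The dilation is Mathlib's `MeasurableEquiv.smul₀ s hs` on `ChainConfig = ℤ → ℝ × ℝ` (`dilEquiv`),
  acting as `(s • σ) i = (s q_i, s p_i)`.
* The two `Measure.tilted` transport lemmas are general measure theory; the first has the same
  statement as `HierarchicalRG.tilted_smul_measure`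
  (`Literature/Barriers/CriticalPhenomena/RigorousRGSmallParameterKochWittwerReduction.lean`) and is
  restated (15 lines) rather than imported, to keep this cone free of the renormalisation-group
  barrier cone; a shared home under `Literature/MeasureTheory/` is the librarian's call.
* No measurability or integrability hypothesis on the Hamiltonian is needed anywhere: the kernel
  identity holds including the junk case `Z = ∞` (both sides are then `0`).
-/

noncomputable section

open MeasureTheory Filter Set Topology
open scoped ENNReal
open Literature.Probability.LatticeModels

namespace Literature.MathematicalPhysics.KineticTheory.HeatConduction

/-! ### Two transport lemmas for `Measure.tilted` -/

section TiltedAPI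
variable {α δ : Type*} [MeasurableSpace α] [MeasurableSpace δ]

/-- Tilting forgets a finite non-zero scalar factor of the base measure: `(r • μ).tilted f =
μ.tilted f` (the normaliser scales by the same factor). Same statement as
`HierarchicalRG.tilted_smul_measure`, restated to keep the import cone small. [folklore] -/
theorem tilted_of_smul_measure (μ : Measure α) (f : α → ℝ) {r : ℝ≥0∞} (hr0 : r ≠ 0)
    (hr : r ≠ ∞) : (r • μ).tilted f = μ.tilted f := by
  rw [Measure.tilted, Measure.tilted, withDensity_smul_measure, integral_smul_measure,
    ← withDensity_smul' _ _ hr]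
  congr 1
  funext x
  have hrr : 0 < r.toReal := ENNReal.toReal_pos hr0 hr
  have hr' : r = ENNReal.ofReal r.toReal := (ENNReal.ofReal_toReal hr).symm
  simp only [Pi.smul_apply, smul_eq_mul]
  generalize hρ : r.toReal = ρ at hrr hr'
  rw [hr', ← ENNReal.ofReal_mul hrr.le]
  congr 1
  by_cases hZ : (∫ x, Real.exp (f x) ∂μ) = 0
  · simp [hZ]
  · field_simp

/-- Tilting a push-forward along a measurable equivalence is the push-forward of the tilt by the
pulled-back exponent: `(μ ∘ e⁻¹).tilted f = (μ.tilted (f ∘ e)) ∘ e⁻¹` (change of variables; no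
measurability of `f` is needed). [folklore] -/
theorem tilted_map_equiv (μ : Measure α) (e : α ≃ᵐ δ) (f : δ → ℝ) :
    (μ.map e).tilted f = (μ.tilted (f ∘ e)).map e := by
  ext s hs
  rw [Measure.map_apply e.measurable hs, tilted_apply' _ _ hs,
    tilted_apply' _ _ (e.measurable hs), integral_map_equiv, Measure.restrict_map e.measurable hs,
    lintegral_map_equiv]
  simp only [Function.comp_apply]

end TiltedAPI

/-! ### The dilation `σ ↦ s • σ` of `ChainConfig` -/

/-- The amplitude dilation `S_s : σ ↦ s • σ`, `(s • σ)_i = (s q_i, s p_i)`, as a measurable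
automorphism of `ChainConfig` (`s ≠ 0`). [cite: AokiLukkarinenSpohn2006, §2 eq. (2.8)] -/
def dilEquiv {s : ℝ} (hs : s ≠ 0) : ChainConfig ≃ᵐ ChainConfig := MeasurableEquiv.smul₀ s hs

/-- `dilEquiv hs σ = s • σ`. [folklore] -/
@[simp] theorem dilEquiv_apply {s : ℝ} (hs : s ≠ 0) (σ : ChainConfig) : dilEquiv hs σ = s • σ :=
  congrFun (MeasurableEquiv.coe_smul₀ hs) σ

/-- The inverse dilation is the dilation by `s⁻¹`. [folklore] -/
theorem dilEquiv_symm {s : ℝ} (hs : s ≠ 0) : (dilEquiv hs).symm = dilEquiv (inv_ne_zero hs) :=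
  MeasurableEquiv.symm_smul₀ hs

/-- `(dilEquiv hs)⁻¹ σ = s⁻¹ • σ`. [folklore] -/
@[simp] theorem dilEquiv_symm_apply {s : ℝ} (hs : s ≠ 0) (σ : ChainConfig) :
    (dilEquiv hs).symm σ = s⁻¹ • σ := by
  rw [dilEquiv_symm, dilEquiv_apply]

/-- `(μ ∘ S_s⁻¹) ∘ S_{s⁻¹}⁻¹ = μ`. [folklore] -/
theorem map_dilEquiv_map_dilEquiv_inv {s : ℝ} (hs : s ≠ 0) (μ : Measure ChainConfig) :
    (μ.map (dilEquiv hs)).map (dilEquiv (inv_ne_zero hs)) = μ := by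
  rw [← dilEquiv_symm hs]
  exact MeasurableEquiv.map_symm_map (dilEquiv hs)

/-! ### The potential, the finite-volume Hamiltonians and the Gibbs kernels under the dilation -/

section Scaling
variable (ω₂ lam β γ : ℝ)

/-- POTENTIAL SCALING: `Φ^{lam,β}_A(s • σ) = s² · Φ^{lam s²,β s²}_A(σ)` for every interaction set `A`
(on-site term `½(sp)² + U_{lam}(sq) = s²(½p² + U_{lam s²}(q))`, bond term `V_β(s r) = s² V_{β s²}(r)`).
[cite: AokiLukkarinenSpohn2006, §2 eqs. (2.9)-(2.10)] -/
theorem chainPotential_smul (s : ℝ) (A : Finset ℤ) (σ : ChainConfig) :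
    (pinnedChain ω₂ lam β γ).chainPotential A (s • σ) =
      s ^ 2 * (pinnedChain ω₂ (lam * s ^ 2) (β * s ^ 2) γ).chainPotential A σ := by
  simp only [OscillatorChain.chainPotential, pinnedChain, Pi.smul_apply, Prod.smul_fst,
    Prod.smul_snd, smul_eq_mul]
  rw [mul_add, Finset.mul_sum, Finset.mul_sum]
  congr 1
  · refine Finset.sum_congr rfl fun x _ => ?_
    split_ifs <;> ring
  · refine Finset.sum_congr rfl fun x _ => ?_
    split_ifs <;> ring

/-- HAMILTONIAN SCALING in every finite volume: `H_Λ(s • σ) = s² H'_Λ(σ)` (LLL (10) / Georgii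
(2.11) Hamiltonian of the chain specification). [cite: AokiLukkarinenSpohn2006, §2 eq. (2.10)] -/
theorem hamiltonianIn_chain_smul (s : ℝ) (Λ : Finset ℤ) (σ : ChainConfig) :
    hamiltonianIn (pinnedChain ω₂ lam β γ).chainPotential OscillatorChain.chainSupp Λ (s • σ) =
      s ^ 2 * hamiltonianIn (pinnedChain ω₂ (lam * s ^ 2) (β * s ^ 2) γ).chainPotential
        OscillatorChain.chainSupp Λ σ := by
  simp only [hamiltonianIn, chainPotential_smul, Finset.mul_sum]

/-- BOLTZMANN EXPONENT: `-(s²T)⁻¹ H_Λ(s • σ) = -T⁻¹ H'_Λ(σ)` — the weight of the `(lam, β)` chain at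
temperature `s²T` at `s • σ` is the weight of the `(lam s², β s²)` chain at `T` at `σ`. [folklore] -/
theorem boltzmannExponent_smul {s : ℝ} (hs : s ≠ 0) (T : ℝ) (Λ : Finset ℤ) (σ : ChainConfig) :
    -(s ^ 2 * T)⁻¹ * hamiltonianIn (pinnedChain ω₂ lam β γ).chainPotential
        OscillatorChain.chainSupp Λ (s • σ) =
      -T⁻¹ * hamiltonianIn (pinnedChain ω₂ (lam * s ^ 2) (β * s ^ 2) γ).chainPotential
        OscillatorChain.chainSupp Λ σ := by
  rw [hamiltonianIn_chain_smul, mul_inv]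
  have hs2 : s ^ 2 ≠ 0 := pow_ne_zero 2 hs
  field_simp

/-- Gluing a finite configuration into a boundary condition commutes with the dilation. [folklore] -/
theorem glueWith_smul (s : ℝ) (Λ : Finset ℤ) (ζ : Λ → ℝ × ℝ) (η : ChainConfig) :
    glueWith Λ (s • ζ) (s • η) = s • glueWith Λ ζ η := by
  funext x
  by_cases hx : x ∈ Λ
  · simp only [glueWith_apply_mem _ _ _ hx, Pi.smul_apply]
  · simp only [glueWith_apply_not_mem _ _ _ hx, Pi.smul_apply]

/-- **KERNEL CONJUGACY.** For `s ≠ 0`, every finite `Λ` and boundary condition `η`: the finite-volume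
Gibbs distribution of the `(lam, β)` chain at temperature `s²T` with boundary condition `s • η` is
the push-forward by `σ ↦ s • σ` of that of the `(lam s², β s²)` chain at temperature `T` with
boundary condition `η` (the Jacobian `|s|^{-2|Λ|}` of the a priori Lebesgue measure is absorbed by
the normalisation; valid also in the junk case). [cite: AokiLukkarinenSpohn2006, §2 eqs. (2.8)-(2.13)] -/
theorem chainSpecification_smul {s : ℝ} (hs : s ≠ 0) (T : ℝ) (Λ : Finset ℤ) (η : ChainConfig) :
    (pinnedChain ω₂ lam β γ).chainSpecification (s ^ 2 * T) Λ (s • η) =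
      ((pinnedChain ω₂ (lam * s ^ 2) (β * s ^ 2) γ).chainSpecification T Λ η).map (dilEquiv hs) := by
  simp only [OscillatorChain.chainSpecification, gibbsSpecOfPotential]
  set π : Measure (Λ → ℝ × ℝ) := Measure.pi fun _ => (volume : Measure (ℝ × ℝ)) with hπdef
  set c : ℝ≥0∞ := ENNReal.ofReal |((s⁻¹) ^ Module.finrank ℝ (Λ → ℝ × ℝ))⁻¹| with hcdef
  have hc0 : c ≠ 0 := by
    rw [hcdef]
    exact (ENNReal.ofReal_pos.mpr
      (abs_pos.mpr (inv_ne_zero (pow_ne_zero _ (inv_ne_zero hs))))).ne'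
  have hctop : c ≠ ∞ := ENNReal.ofReal_ne_top
  have hglue : (fun ζ : Λ → ℝ × ℝ => glueWith Λ ζ (s • η)) =
      (dilEquiv hs) ∘ ((fun ζ : Λ → ℝ × ℝ => glueWith Λ ζ η) ∘ (fun ζ : Λ → ℝ × ℝ => s⁻¹ • ζ)) := by
    funext ζ
    simp only [Function.comp_apply, dilEquiv_apply, ← glueWith_smul, smul_inv_smul₀ hs]
  haveI : (volume : Measure (ℝ × ℝ)).IsAddHaarMeasure :=
    Measure.prod.instIsAddHaarMeasure volume volume
  have hπ : π.map (fun ζ : Λ → ℝ × ℝ => s⁻¹ • ζ) = c • π :=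
    Measure.map_addHaar_smul π (inv_ne_zero hs)
  have hG : Measurable (fun ζ : Λ → ℝ × ℝ => glueWith Λ ζ η) := measurable_glueWith Λ η
  have hd : Measurable (fun ζ : Λ → ℝ × ℝ => s⁻¹ • ζ) := measurable_const_smul s⁻¹
  have hbase : π.map (fun ζ : Λ → ℝ × ℝ => glueWith Λ ζ (s • η)) =
      c • ((π.map (fun ζ : Λ → ℝ × ℝ => glueWith Λ ζ η)).map (dilEquiv hs)) := by
    rw [hglue, ← Measure.map_map (dilEquiv hs).measurable (hG.comp hd), ← Measure.map_map hG hd,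
      hπ, Measure.map_smul, Measure.map_smul]
  rw [hbase, tilted_of_smul_measure _ _ hc0 hctop, tilted_map_equiv]
  congr 2
  funext σ
  simp only [Function.comp_apply, dilEquiv_apply]
  exact boltzmannExponent_smul ω₂ lam β γ hs T Λ σ

/-- **DLR CONJUGACY (forward).** A Gibbs state of the `(lam s², β s²)` chain at temperature `T`
pushes forward under `σ ↦ s • σ` to a Gibbs state of the `(lam, β)` chain at temperature `s²T`.
[cite: AokiLukkarinenSpohn2006, §2 eqs. (2.8)-(2.13)] -/
theorem isChainGibbsMeasure_map_dil {s : ℝ} (hs : s ≠ 0) {T : ℝ} {μ : Measure ChainConfig}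
    (h : (pinnedChain ω₂ (lam * s ^ 2) (β * s ^ 2) γ).IsChainGibbsMeasure T μ) :
    (pinnedChain ω₂ lam β γ).IsChainGibbsMeasure (s ^ 2 * T) (μ.map (dilEquiv hs)) := by
  unfold OscillatorChain.IsChainGibbsMeasure IsGibbsMeasure at h ⊢
  obtain ⟨hprob, hDLR⟩ := h
  refine ⟨Measure.isProbabilityMeasure_map (dilEquiv hs).measurable.aemeasurable,
    fun Λ A hA => ?_⟩
  have hA' : MeasurableSet ((dilEquiv hs) ⁻¹' A) := (dilEquiv hs).measurable hA
  rw [lintegral_map_equiv, MeasurableEquiv.map_apply, ← hDLR Λ _ hA']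
  refine lintegral_congr fun η => ?_
  rw [dilEquiv_apply, chainSpecification_smul ω₂ lam β γ hs T Λ η, MeasurableEquiv.map_apply]

/-- **DLR CONJUGACY (iff).** `μ ∘ S_s⁻¹` is a Gibbs state of the `(lam, β)` chain at `s²T` iff `μ`
is a Gibbs state of the `(lam s², β s²)` chain at `T`. [cite: AokiLukkarinenSpohn2006, §2 eqs. (2.8)-(2.13)] -/
theorem isChainGibbsMeasure_map_dil_iff {s : ℝ} (hs : s ≠ 0) (T : ℝ) (μ : Measure ChainConfig) :
    (pinnedChain ω₂ lam β γ).IsChainGibbsMeasure (s ^ 2 * T) (μ.map (dilEquiv hs)) ↔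
      (pinnedChain ω₂ (lam * s ^ 2) (β * s ^ 2) γ).IsChainGibbsMeasure T μ := by
  refine ⟨fun h => ?_, isChainGibbsMeasure_map_dil ω₂ lam β γ hs⟩
  have key := isChainGibbsMeasure_map_dil ω₂ (lam * s ^ 2) (β * s ^ 2) γ (inv_ne_zero hs)
    (T := s ^ 2 * T) (μ := μ.map (dilEquiv hs))
  have e1 : lam * s ^ 2 * s⁻¹ ^ 2 = lam := by field_simp
  have e2 : β * s ^ 2 * s⁻¹ ^ 2 = β := by field_simp
  have e3 : s⁻¹ ^ 2 * (s ^ 2 * T) = T := by field_simp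
  rw [e1, e2, e3, map_dilEquiv_map_dilEquiv_inv] at key
  exact key h

/-- **LOW TEMPERATURE IS WEAK ANHARMONICITY (DLR form).** For `T > 0`, Gibbs states of
`pinnedChain ω₂ lam β γ` at temperature `T` are exactly the push-forwards under `σ ↦ √T • σ` of the
Gibbs states of `pinnedChain ω₂ (lam T) (β T) γ` at temperature `1`; in particular one exists iff
the other does. [cite: AokiLukkarinenSpohn2006, §2 eq. (2.13)] -/
theorem exists_isChainGibbsMeasure_iff_unit_temp {T : ℝ} (hT : 0 < T) :
    (∃ μ : Measure ChainConfig, (pinnedChain ω₂ lam β γ).IsChainGibbsMeasure T μ) ↔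
      ∃ μ : Measure ChainConfig, (pinnedChain ω₂ (lam * T) (β * T) γ).IsChainGibbsMeasure 1 μ := by
  have hs : Real.sqrt T ≠ 0 := (Real.sqrt_pos.mpr hT).ne'
  have hs2 : Real.sqrt T ^ 2 = T := Real.sq_sqrt hT.le
  constructor
  · rintro ⟨μ, hμ⟩
    refine ⟨μ.map (dilEquiv (inv_ne_zero hs)), ?_⟩
    have key := (isChainGibbsMeasure_map_dil_iff ω₂ (lam * T) (β * T) γ (inv_ne_zero hs) T μ).2
    have e1 : lam * T * (Real.sqrt T)⁻¹ ^ 2 = lam := by rw [inv_pow, hs2]; field_simp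
    have e2 : β * T * (Real.sqrt T)⁻¹ ^ 2 = β := by rw [inv_pow, hs2]; field_simp
    have e3 : (Real.sqrt T)⁻¹ ^ 2 * T = 1 := by rw [inv_pow, hs2]; field_simp
    rw [e1, e2, e3] at key
    exact key hμ
  · rintro ⟨μ, hμ⟩
    refine ⟨μ.map (dilEquiv hs), ?_⟩
    have key := (isChainGibbsMeasure_map_dil_iff ω₂ lam β γ hs 1 μ).2
    rw [hs2, mul_one] at key
    exact key hμ

end Scaling

end Literature.MathematicalPhysics.KineticTheory.HeatConduction

end
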